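import Summits.BirchSwinnertonDyer.BirchSwinnertonDyer.Theorems.EisensteinPrimesTwoVariableCharMainConjOfRubin
import Summits.BirchSwinnertonDyer.Rank1Residual.X11b.CharacterSupply
import Summits.BirchSwinnertonDyer.Rank1Residual.X11b.IntSeriesValueRigidity
import Summits.BirchSwinnertonDyer.Rank1Residual.X11b.Three.UnrSeriesTwistCharacter
import Literature.NumberTheory.EllipticCurves.DeShalit1987.KatzPAdicLFunctionFunctionalEquation
import Literature.NumberTheory.EllipticCurves.Hida2010MuInvariant.AnticyclotomicKatzBranchMuInvariant
import Literature.NumberTheory.GaloisRepresentations.WeakAbelianDirectSummandProofs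
import Literature.NumberTheory.GaloisRepresentations.CMTypeHeckeCharacter
import Literature.NumberTheory.GaloisRepresentations.ArtinRestriction
import HarnessLib

/-!
# (R5′), `μ`-half: the anticyclotomic slice of Rubin's two-variable frame has unit content —
# `g(S=0) mod p ≠ 0` from de Shalit's functional equation (F) and Hida's `μ = 0` (O1)
# (helper file 27 for crux 2 `GoodLatticeBDPValue`, stmt-BirchSwinnertonDyer-19032, cell `bsd-eis` seat `bsd-eis-k5-c2`)

THE INPUT `g(S=0) mod p ≠ 0` OF `muLambda_of_rubin` / `muLambda_of_rubin_trivial`, discharged from two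
PUBLISHED named facts — (F) `DeShalit1987.thmII64_katzMeasure₂_functionalEquation` (p448026) and
(O1) `Hida2010MuInvariant.thmI_mu_katzBranch_reflect_eq_zero` (p478863, Hida 2010 Thm. I on the
reflected de Shalit frame; k5-ty BETA-SPEC §3 / RULING L26) — and KERNEL THEOREMS ONLY, following the
chain of HOME/k5-ty-g6/BETA-SPEC.md §3 and STATUS 2026-08-26T23:56:03Z (POINTER):

1. §1 values on `𝓞_{ℂ_p}⟦T⟧`: constants (`intSeries_hasValueAt_C_mul`), and `(1 + T)^a` mapped along a
   structure map `J : ℤ_p → 𝓞_{ℂ_p}` evaluated at `χ(1) − 1` gives `χ(a)`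
   (`intSeries_hasValueAt_binomialSeries_map`, from x11b3's `hasValueAt_binomialSeries_addChar`);
2. §2 **`map_constantCoeff_eq_of_relation`** — the SERIES IDENTITY: if for every character `r`
   through the anticyclotomic `κ` the values of the slices at `r(γ⁻¹) − 1` satisfy
   `G(x) = C · r(g₀) · G_c(x)` (the relation handed over by (F)`.anticyclotomicLine_left`), then
   `G(·,0) = C · (1+T)^{−κ(g₀)} · G_c(·,0)` in `𝓞_{ℂ_p}⟦T⟧` — uniqueness from the values along the
   character supply `X11b.characterSupplyAt` (`X11b.R1.intSeries_eq_of_hasValueAt`); hence the two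
   slices are ASSOCIATED and have the same unit-content verdict;
3. §3 **`map_residue_constantCoeff_ne_zero_of_katzMeasure₂`** — for the data of `CharMainConjOnTree`
   (+ a complement `(κ', γ')`, the exact ramification set `S` of `θ_K`, `θ_K` of finite order and
   `c`-invariant), every two-variable frame `G` of `θ_K⁻¹` at the inverse generators
   (`IsKatzMeasure₂`) and every `g ∈ Λ₂` with `J(g) ~ G`: `g(S=0) mod p ≠ 0`. (F) gives the reflected
   slice `G_c(·,0)`, a de Shalit branch of `reflect θ_K⁻¹ = θ_K·‖·‖` at `γ⁻¹` over `S̄ = S`; (O1)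
   gives it unit content; §2 transports unit content to `G(·,0)`; k5-ty's
   `map_residue_ne_zero_iff_hasUnitContent_of_associated` reads it on `g(S=0)`.

NET for the road: with (I2) + (iv′) (`muLambda_of_rubin(_trivial)`), (F) and (O1) — FOUR published
theorems stated as named facts — `μ(𝔛_θ) = 0` and `λ(𝔛_θ) = ord(g(S=0) mod p) + [θ|_{G_K} = 𝟙]` hold
in the kernel for the anomalous branches, modulo SN2 (`p ∤ h_K`) and the two displayed properties of
`θ_K` (finite order — true for the `θ_K` of `exists_heckeCharacter_of_pow_eq_one` —, `c`-invariance
— CFT functoriality, not yet in the tree). What is NOT here: the `λ`-half of (R5′) in the CGLS currency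
(`FirstUnitCoeffAt L …` for an INDEPENDENT `IsKatzLFunction` witness `L`), which is the XL cross-frame
comparison (β) of BETA-SPEC §2. HONEST FRAMING: a CONDITIONAL on published theorems stated as named
facts; nothing about BSD; closes nothing by itself.
References: de Shalit 1987 II.6.4; Hida 2010 Thm. I; Rubin 1991 Thm. 4.1; Keller–Yin 2024 Thm. 1.2.2;
CGLS 2022 Thm. 2.1.2 / proof of Thm. 2.2.2; HOME/k5-ty-g6/BETA-SPEC.md; MEMO-4/5.
-/

-- the summit namespace `Summit.BirchSwinnertonDyer.BirchSwinnertonDyer` repeats the problem name by design (D-0017)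
set_option linter.dupNamespace false
set_option autoImplicit false

noncomputable section

open scoped Classical Topology

open Filter NumberField IsDedekindDomain Field PowerSeries
  Literature.NumberTheory.GaloisRepresentations
  Literature.NumberTheory.EllipticCurves Literature.NumberTheory.EllipticCurves.GreenbergVatsal2000
  Literature.NumberTheory.EllipticCurves.KellerYin2024
  Literature.NumberTheory.EllipticCurves.Rubin1991 Literature.NumberTheory.EllipticCurves.DeShalit1987
  Literature.NumberTheory.EllipticCurves.Hida2010MuInvariant
  Summit.BirchSwinnertonDyer.Rank1Residual.X11b Summit.BirchSwinnertonDyer.Rank1Residual.X11b.Halves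

namespace Summit.BirchSwinnertonDyer.BirchSwinnertonDyer.Theorems.IwasawaTwoVariable

/-! ## §1 Values on `𝓞_{ℂ_p}⟦T⟧`: constants and `(1 + T)^a` along a structure map -/

section Values

variable {p : ℕ} [Fact p.Prime]

/-- Multiplying by a constant `c ∈ 𝓞_{ℂ_p}` multiplies the value by `c`. [folklore] -/
theorem intSeries_hasValueAt_C_mul {Q : PowerSeries 𝓞_ℂ_[p]} {x v : ℂ_[p]} (c : 𝓞_ℂ_[p])
    (hQ : IntSeries.HasValueAt Q x v) :
    IntSeries.HasValueAt (PowerSeries.C c * Q) x ((c : ℂ_[p]) * v) := by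
  unfold IntSeries.HasValueAt at hQ ⊢
  have h := hQ.mul_left (c : ℂ_[p])
  refine h.congr_fun fun k ↦ ?_
  rw [PowerSeries.coeff_C_mul, MulMemClass.coe_mul, mul_assoc]

/-- **`(1 + T)^a`, read in `𝓞_{ℂ_p}⟦T⟧` along a structure map `J : ℤ_p → 𝓞_{ℂ_p}`, evaluated at
`T = χ(1) − 1` is `χ(a)`** for every continuous additive character `χ : ℤ_p → ℂ_p` (x11b3's
`hasValueAt_binomialSeries_addChar` in `R₀⟦T⟧`, transported coefficientwise). [folklore] -/
theorem intSeries_hasValueAt_binomialSeries_map {J : ℤ_[p] →+* 𝓞_ℂ_[p]}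
    (hJ : ∀ x : ℤ_[p], ((J x : 𝓞_ℂ_[p]) : ℂ_[p]) = ((x : ℚ_[p]) : ℂ_[p]))
    (χ : AddChar ℤ_[p] ℂ_[p]) (hχ : Continuous χ) (a : ℤ_[p]) :
    IntSeries.HasValueAt ((binomialSeries ℤ_[p] a).map J) (χ 1 - 1) (χ a) := by
  rw [IntSeries.hasValueAt_iff_of_coeff_eq (L := (binomialSeries ℤ_[p] a).map (toUnr p))]
  · exact hasValueAt_binomialSeries_addChar χ hχ a
  · intro k
    rw [PowerSeries.coeff_map, hJ, coe_coeff_binomialSeries_map, binomialSeries_coeff, smul_eq_mul,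
      mul_one, PadicComplex.coe_eq, ← IsScalarTower.algebraMap_apply]

/-- A structure map sends `(1 + T)^a` to a unit of `𝓞_{ℂ_p}⟦T⟧` (constant coefficient `1`).
[folklore] -/
theorem isUnit_binomialSeries_map_int (J : ℤ_[p] →+* 𝓞_ℂ_[p]) (a : ℤ_[p]) :
    IsUnit ((binomialSeries ℤ_[p] a).map J) := by
  rw [PowerSeries.isUnit_iff_constantCoeff, ← PowerSeries.coeff_zero_eq_constantCoeff_apply,
    PowerSeries.coeff_map, binomialSeries_coeff, Ring.choose_zero_right, one_smul, map_one]
  exact isUnit_one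

end Values

/-! ## §2 The series identity `G(·,0) = C·(1+T)^{-κ(g₀)}·G_c(·,0)` from the pointwise relation -/

section SeriesIdentity

variable {K : Type} [Field K] [NumberField K] {p : ℕ} [Fact p.Prime]

/-- **The pointwise relation of (F) on the anticyclotomic line is a SERIES identity.** `K` imaginary
quadratic, `p` odd, `κ` anticyclotomic with topological generator `γ`, `J : ℤ_p → 𝓞_{ℂ_p}` a structure
map; if two `G, G_c ∈ 𝓞_{ℂ_p}⟦T⟧` satisfy `G(r(γ⁻¹) − 1) = C · r(g₀) · G_c(r(γ⁻¹) − 1)` for EVERY rank-one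
character `r` through `κ` (the relation of
`DeShalit1987.thmII64_katzMeasure₂_functionalEquation.anticyclotomicLine_left` at the socket's `γ⁻¹`),
then `G = C · (1+T)^{−κ(g₀)} · G_c`: both sides take the same value at `r_k(γ⁻¹) − 1 → 0` along the
character supply `X11b.characterSupplyAt` (`r_k(g₀) = (1+T)^{−κ(g₀)}` at `T = r_k(γ⁻¹) − 1`, since
`κ(γ⁻¹) = −1`), so they agree by `X11b.R1.intSeries_eq_of_hasValueAt`.
[cite: deShalit1987, II.6.4 (9), (14)–(15) (store chunk 84–85)] [cite: Cassels1986, Ch. 4 Thm. 4.1] -/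
theorem eq_C_mul_binomial_mul_of_relation (hp2 : p ≠ 2) (hK : IsImaginaryQuadratic K)
    (ι' : PadicAlgCl p ≃+* ℂ) {κ : ZpExtension K p} (hκ : κ.IsAnticyclotomic)
    {γ : absoluteGaloisGroup K} (hγ : κ.IsTopGenerator γ)
    {J : ℤ_[p] →+* 𝓞_ℂ_[p]} (hJ : ∀ x : ℤ_[p], ((J x : 𝓞_ℂ_[p]) : ℂ_[p]) = ((x : ℚ_[p]) : ℂ_[p]))
    {Gs Gcs : PowerSeries 𝓞_ℂ_[p]} {C : ℂ_[p]} (hC : ‖C‖ = 1) (g₀ : absoluteGaloisGroup K)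
    (hrel : ∀ r : FramedGaloisRep K (PadicAlgCl p) 1, FactorsThroughZp κ r → ∀ x : ℂ_[p],
      IntSeries.HasValueAt Gcs (avatarValueAt r γ⁻¹ - 1) x →
      IntSeries.HasValueAt Gs (avatarValueAt r γ⁻¹ - 1) (C * avatarValueAt r g₀ * x)) :
    Gs = PowerSeries.C (⟨C, mem_padicComplexInt_iff.mpr hC.le⟩ : 𝓞_ℂ_[p]) *
      ((binomialSeries ℤ_[p] (-(Multiplicative.toAdd (κ g₀)))).map J * Gcs) := by
  set a : ℤ_[p] := -(Multiplicative.toAdd (κ g₀)) with ha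
  set U : PowerSeries 𝓞_ℂ_[p] := (binomialSeries ℤ_[p] a).map J with hU
  set c : 𝓞_ℂ_[p] := ⟨C, mem_padicComplexInt_iff.mpr hC.le⟩ with hc
  -- the character supply along `κ` at `γ`
  obtain ⟨m, x₀, φ, φ', r, r', -, hne, hlim, -, -, -, hfac, hval, -⟩ :=
    characterSupplyAt hp2 K ι' κ γ hK hκ hγ
  -- values at `γ⁻¹` and at `g₀` through the additive character of `r k`
  have hx0 : ∀ k, x₀ ^ p ^ k ≠ 0 := fun k h0 ↦ by
    have h := avatarValueAt_mul (r k) γ γ⁻¹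
    rw [mul_inv_cancel, avatarValueAt_one, hval k, h0, zero_mul] at h
    exact one_ne_zero h
  have hinv : ∀ k, avatarValueAt (r k) γ⁻¹ = (x₀ ^ p ^ k)⁻¹ := fun k ↦ by
    have h := avatarValueAt_mul (r k) γ γ⁻¹
    rw [mul_inv_cancel, avatarValueAt_one, hval k] at h
    exact (eq_inv_of_mul_eq_one_right h.symm)
  -- for each `k`: the additive character `χ'` with `χ'(1) = r_k(γ⁻¹)`, `χ'(a) = r_k(g₀)`
  have hchar : ∀ k, ∃ χ' : AddChar ℤ_[p] ℂ_[p], Continuous χ' ∧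
      χ' 1 = avatarValueAt (r k) γ⁻¹ ∧ χ' a = avatarValueAt (r k) g₀ := by
    intro k
    obtain ⟨χ, hχc, hχ⟩ := exists_addChar_of_factorsThroughZp (hfac k)
    refine ⟨χ.compAddMonoidHom (-AddMonoidHom.id ℤ_[p]), hχc.comp (continuous_neg), ?_, ?_⟩
    · rw [AddChar.compAddMonoidHom_apply, AddMonoidHom.neg_apply, AddMonoidHom.id_apply, ← hχ γ⁻¹,
        map_inv, toAdd_inv, show κ γ = Multiplicative.ofAdd 1 from hγ, toAdd_ofAdd]
    · rw [AddChar.compAddMonoidHom_apply, AddMonoidHom.neg_apply, AddMonoidHom.id_apply, ha, neg_neg,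
        hχ g₀]
  -- the points `t_k = r_k(γ⁻¹) − 1`: in the open disc, `→ 0`, never `0`
  set t : ℕ → ℂ_[p] := fun k ↦ avatarValueAt (r k) γ⁻¹ - 1 with ht
  have htlt : ∀ k, ‖t k‖ < 1 := fun k ↦ by
    obtain ⟨χ', hχ'c, h1, -⟩ := hchar k
    rw [ht]
    dsimp only
    rw [← h1]
    exact norm_map_one_sub_one_lt χ' hχ'c
  have htlim : Tendsto t atTop (𝓝 0) := by
    have h1 : Tendsto (fun k ↦ (x₀ ^ p ^ k)⁻¹) atTop (𝓝 1) := by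
      have := hlim.inv₀ one_ne_zero
      rwa [inv_one] at this
    have h2 : Tendsto (fun k ↦ (x₀ ^ p ^ k)⁻¹ - 1) atTop (𝓝 0) := by
      rw [← sub_self (1 : ℂ_[p])]
      exact h1.sub_const 1
    refine h2.congr fun k ↦ ?_
    rw [ht]
    dsimp only
    rw [hinv k]
  have htne : ∃ᶠ k in atTop, t k ≠ 0 := Frequently.of_forall fun k ↦ by
    rw [ht]
    dsimp only
    rw [hinv k, sub_ne_zero, Ne, inv_eq_one]
    exact hne k
  -- values of `G_c(·,0)` at `t_k`, and the two sides there
  choose y hy using fun k ↦ intSeries_exists_hasValueAt Gcs (htlt k)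
  have hGs : ∀ k, IntSeries.HasValueAt Gs (t k) (C * avatarValueAt (r k) g₀ * y k) :=
    fun k ↦ hrel (r k) (hfac k) (y k) (hy k)
  have hP : ∀ k, IntSeries.HasValueAt (PowerSeries.C c * (U * Gcs)) (t k)
      (C * avatarValueAt (r k) g₀ * y k) := by
    intro k
    obtain ⟨χ', hχ'c, h1, h2⟩ := hchar k
    have hUval : IntSeries.HasValueAt U (t k) (avatarValueAt (r k) g₀) := by
      rw [← h2, ht]
      dsimp only
      rw [← h1]
      exact intSeries_hasValueAt_binomialSeries_map hJ χ' hχ'c a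
    have h := intSeries_hasValueAt_C_mul c (intSeries_hasValueAt_mul (htlt k) hUval (hy k))
    rw [mul_assoc]
    exact h
  exact R1.intSeries_eq_of_hasValueAt htlim htne hGs hP

/-- Hence the two slices are ASSOCIATED in `𝓞_{ℂ_p}⟦T⟧` (`C` is a unit of `𝓞_{ℂ_p}` since `‖C‖ = 1`,
`(1+T)^a` is a unit). [folklore] -/
theorem associated_of_relation (hp2 : p ≠ 2) (hK : IsImaginaryQuadratic K)
    (ι' : PadicAlgCl p ≃+* ℂ) {κ : ZpExtension K p} (hκ : κ.IsAnticyclotomic)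
    {γ : absoluteGaloisGroup K} (hγ : κ.IsTopGenerator γ)
    {J : ℤ_[p] →+* 𝓞_ℂ_[p]} (hJ : ∀ x : ℤ_[p], ((J x : 𝓞_ℂ_[p]) : ℂ_[p]) = ((x : ℚ_[p]) : ℂ_[p]))
    {Gs Gcs : PowerSeries 𝓞_ℂ_[p]} {C : ℂ_[p]} (hC : ‖C‖ = 1) (g₀ : absoluteGaloisGroup K)
    (hrel : ∀ r : FramedGaloisRep K (PadicAlgCl p) 1, FactorsThroughZp κ r → ∀ x : ℂ_[p],
      IntSeries.HasValueAt Gcs (avatarValueAt r γ⁻¹ - 1) x →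
      IntSeries.HasValueAt Gs (avatarValueAt r γ⁻¹ - 1) (C * avatarValueAt r g₀ * x)) :
    Associated Gcs Gs := by
  have hc : IsUnit (⟨C, mem_padicComplexInt_iff.mpr hC.le⟩ : 𝓞_ℂ_[p]) :=
    isUnit_padicComplexInt_iff.mpr hC
  have hU := isUnit_binomialSeries_map_int J (-(Multiplicative.toAdd (κ g₀)))
  obtain ⟨u, hu⟩ := (hc.map (PowerSeries.C (R := 𝓞_ℂ_[p]))).mul hU
  refine ⟨u, ?_⟩
  rw [eq_C_mul_binomial_mul_of_relation hp2 hK ι' hκ hγ hJ hC g₀ hrel, hu]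
  ring

end SeriesIdentity

/-! ## §3 `g(S=0) mod p ≠ 0` for Rubin's frame, from (F) and (O1) -/

section Assembly

variable {K : Type} [Field K] [NumberField K] [IsCMField K] {p : ℕ} [Fact p.Prime]

omit [IsCMField K] in
/-- `θ_K` is unramified at every place above `p` (`θ` is unramified at `p`, restriction, `IsHeckeCharOf`).
[cite: SerreAbelianLadic1968, Ch. I §2.1] -/
theorem isUnramifiedAt_of_natCast_mem {ι' : PadicAlgCl p ≃+* ℂ}
    {θ : FramedGaloisRep ℚ (padicCoeffIntegers (∅ : Set (PadicAlgCl p))) 1}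
    (hθp : ∀ u : HeightOneSpectrum (𝓞 ℚ), ((p : ℕ) : 𝓞 ℚ) ∈ u.asIdeal → θ.IsUnramifiedAt u)
    {θK : HeckeCharacter K} (hθK : IsHeckeCharOf ι' (θ.restrictField K) θK)
    {w : HeightOneSpectrum (𝓞 K)} (hw : ((p : ℕ) : 𝓞 K) ∈ w.asIdeal) : θK.IsUnramifiedAt w := by
  refine (hθK w (θ.isUnramifiedAt_restrictField (v := w.under (𝓞 ℚ)) rfl (hθp _ ?_))).1
  change ((p : ℕ) : 𝓞 ℚ) ∈ w.asIdeal.under (𝓞 ℚ)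
  rw [Ideal.under_def, Ideal.mem_comap, map_natCast]
  exact hw

/-- **(R5′), `μ`-half: `g(S=0) mod p ≠ 0` for Rubin's two-variable frame.** Data of
`CharMainConjOnTree` (`K` imaginary quadratic and CM, `2 < p` split, Heegner hypothesis for `p`,
`D_K` odd `≠ −3`, `v` read through `ι` and induced by `ι'`, `κ` anticyclotomic with topological
generator `γ`, `θ` a `(p−1)`-torsion character of `Γ_ℚ` unramified off a Heegner integer `C` and at
`p`, its Hecke character `θ_K`), a complement `(κ', γ')` to a generator pair, `θ_K` of FINITE ORDER
and `c`-INVARIANT (displayed), the exact ramification set `S` of `θ_K`; then for every two-variable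
Katz frame `G` of `θ_K⁻¹` at the inverse generators (de Shalit periods `Ω, δ, Ω_p`) and every
`g ∈ ℤ_p⟦S⟧⟦T⟧` with `J(g) ~ G` for a structure map `J`: **`g(S=0) mod p ≠ 0`** — the input of
`muLambda_of_rubin` / `muLambda_of_rubin_trivial`. From the PUBLISHED facts (F)
`thmII64_katzMeasure₂_functionalEquation` and (O1) `thmI_mu_katzBranch_reflect_eq_zero` and kernel
theorems only (§2, k5-ty's `map_residue_ne_zero_iff_hasUnitContent_of_associated`).
[cite: deShalit1987, II.6.4 Theorem (i) (9), (14)–(15) (store chunk 84–85)]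
[cite: Hida2010MuInvariant, Thm. I (p. 45)]
[cite: KellerYin2024, Thm. 1.2.2 (`Rubin Hida`, arXiv:2402.12781v2 TeX L676–683)] -/
theorem map_residue_constantCoeff_ne_zero_of_katzMeasure₂
    (hF : thmII64_katzMeasure₂_functionalEquation) (hO1 : thmI_mu_katzBranch_reflect_eq_zero)
    (hp : 2 < p) (hK : IsImaginaryQuadratic K) (hHp : SatisfiesHeegnerHypothesis p K)
    (hodd : Odd (NumberField.discr K)) (h3 : NumberField.discr K ≠ -3)
    {ι : K →+* ℚ_[p]} {v vbar : HeightOneSpectrum (𝓞 K)}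
    (hιv : ∀ x : 𝓞 K, x ∈ v.asIdeal ↔ ‖ι (x : K)‖ < 1)
    (hvbar : ((p : ℕ) : 𝓞 K) ∈ vbar.asIdeal) (hne : vbar ≠ v)
    {κ κ' : ZpExtension K p} (hκ : κ.IsAnticyclotomic) {γ γ' : absoluteGaloisGroup K}
    [Fact (κ.IsTopGenerator γ)] (hpair : ZpExtension.IsTopGeneratorPair κ κ' γ γ')
    {ι' : PadicAlgCl p ≃+* ℂ}
    (hι'v : ∀ (w : InfinitePlace K) (k : 𝓞 K), k ∈ v.asIdeal ↔ ‖ι'.symm (w.embedding (k : K))‖ < 1)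
    {θ : FramedGaloisRep ℚ (padicCoeffIntegers (∅ : Set (PadicAlgCl p))) 1}
    (hθ : ∀ σ : absoluteGaloisGroup ℚ, θ σ ^ (p - 1) = 1)
    {C : ℕ} (hC : SatisfiesHeegnerHypothesis C K)
    (hθC : ∀ u : HeightOneSpectrum (𝓞 ℚ), ((C : ℤ) : 𝓞 ℚ) ∉ u.asIdeal → θ.IsUnramifiedAt u)
    (hθp : ∀ u : HeightOneSpectrum (𝓞 ℚ), ((p : ℕ) : 𝓞 ℚ) ∈ u.asIdeal → θ.IsUnramifiedAt u)
    {θK : HeckeCharacter K} (hθK : IsHeckeCharOf ι' (θ.restrictField K) θK)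
    (hfin : θK.IsFiniteOrder) (hgal : HeckeCharacter.galConj (IsCMField.complexConj K) θK = θK)
    {S : Finset (HeightOneSpectrum (𝓞 K))}
    (hS : ∀ w : HeightOneSpectrum (𝓞 K), w ∈ S ↔ ¬ θK.IsUnramifiedAt w)
    {Ω δ : ℂ} {Ωp : (unrIntegers p)ˣ} {G : PowerSeries (PowerSeries 𝓞_ℂ_[p])} (hΩ : Ω ≠ 0)
    (hδ : δ ^ 2 = (NumberField.discr K : ℂ) ∨ δ ^ 2 = -(NumberField.discr K : ℂ))
    (hG : IsKatzMeasure₂ ι' v vbar S κ κ' γ⁻¹ γ'⁻¹ θK⁻¹ Ω δ ((Ωp : unrIntegers p) : ℂ_[p]) G)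
    {g : IwasawaAlgebra₂ p} {J : ℤ_[p] →+* 𝓞_ℂ_[p]}
    (hJ : ∀ x : ℤ_[p], ((J x : 𝓞_ℂ_[p]) : ℂ_[p]) = ((x : ℚ_[p]) : ℂ_[p]))
    (hassoc : Associated (PowerSeries.map (PowerSeries.map J) g) G) :
    (g.map (PowerSeries.constantCoeff (R := ℤ_[p]))).map (IsLocalRing.residue ℤ_[p]) ≠ 0 := by
  have hprime : p.Prime := Fact.out
  have hp2 : p ≠ 2 := by omega
  have hv : ((p : ℕ) : 𝓞 K) ∈ v.asIdeal := natCast_mem_asIdeal_of_norm_iff hιv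
  have hγ : κ.IsTopGenerator γ := Fact.out
  -- `θ_K` (hence `θ_K⁻¹`) is unramified above `p`, ramified exactly on `S`, algebraic
  have hθKv : θK.IsUnramifiedAt v := isUnramifiedAt_of_natCast_mem hθp hθK hv
  have hθKvbar : θK.IsUnramifiedAt vbar := isUnramifiedAt_of_natCast_mem hθp hθK hvbar
  have hvS : v ∉ S := fun h ↦ (hS v).1 h hθKv
  have hvbarS : vbar ∉ S := fun h ↦ (hS vbar).1 h hθKvbar
  have hlam : (θK⁻¹).IsAlgebraic :=
    HeckeCharacter.IsFiniteOrder.isAlgebraic (show IsOfFinOrder θK⁻¹ from IsOfFinOrder.inv hfin)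
  have hprim : ∀ w ∈ S, ¬ (θK⁻¹).IsUnramifiedAt w := fun w hw h ↦ (hS w).1 hw (by
    have h' := h.inv'
    rwa [inv_inv] at h')
  have hunr : ∀ w : HeightOneSpectrum (𝓞 K), w ∉ S → w ≠ v → w ≠ vbar → (θK⁻¹).IsUnramifiedAt w :=
    fun w hw _ _ ↦ (not_not.1 ((hS w).not.1 hw)).inv'
  -- (F) on the anticyclotomic line, at the socket's inverse generators
  obtain ⟨Gc, C₁, g₀, -, hGcB, hC₁, hrel⟩ := hF.anticyclotomicLine_left hK hv hvbar hne hι'v hΩ hδ hvS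
    hvbarS hlam hθKv.inv' hθKvbar.inv' hprim hunr hpair.isUnitGeneratorPair_inv hκ hG
  rw [image_complexConj_eq_of_galConj_eq hgal hS] at hGcB
  -- (O1): the reflected slice has unit content
  have hGc1 : HasUnitContent (PowerSeries.map (PowerSeries.constantCoeff (R := 𝓞_ℂ_[p])) Gc) :=
    hO1.hasUnitContent_of_isTopGenerator_inv hp hK hHp hodd h3 hιv hvbar hne hκ hι'v hθ hC hθC hθp hθK
      hS hΩ hδ hGcB
  -- §2: the two slices are associated, hence `G(·,0)` has unit content
  have hGs1 : HasUnitContent (PowerSeries.map (PowerSeries.constantCoeff (R := 𝓞_ℂ_[p])) G) :=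
    (hasUnitContent_congr_of_associated (associated_of_relation hp2 hK ι' hκ hγ hJ hC₁ g₀ hrel)).1 hGc1
  -- read on `g(S=0)` through the structure map
  have e : PowerSeries.map (PowerSeries.constantCoeff (R := 𝓞_ℂ_[p])) (PowerSeries.map (PowerSeries.map J) g) =
      PowerSeries.map J (g.map (PowerSeries.constantCoeff (R := ℤ_[p]))) := by
    ext n
    simp only [PowerSeries.coeff_map, ← PowerSeries.coeff_zero_eq_constantCoeff_apply]
  have hassoc' : Associated (PowerSeries.map J (g.map (PowerSeries.constantCoeff (R := ℤ_[p]))))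
      (PowerSeries.map (PowerSeries.constantCoeff (R := 𝓞_ℂ_[p])) G) := by
    rw [← e]
    exact hassoc.map (PowerSeries.map (PowerSeries.constantCoeff (R := 𝓞_ℂ_[p])))
  exact (map_residue_ne_zero_iff_hasUnitContent_of_associated hJ hassoc').2 hGs1

end Assembly

end Summit.BirchSwinnertonDyer.BirchSwinnertonDyer.Theorems.IwasawaTwoVariable

end
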